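import Summits.Ventures.PercRepro.Night2NonFatColoop

/-!
# night-2: the NON-FAT case of (FAIR) — more coloop-point corollaries (gen 37)

From `level_one_term_ge_of_coloop` (a coloop point `y`, `rk (W ∖ y) ≤ 3`, contributes `≥ 9 / (2 C(s, 2))`,
`s = |(T ∖ K) ∖ cl (W ∖ y)| ≤ 6`):
* **`basis_pair_fair_of_coloop_s_le_three`**: ONE coloop point whose plane `cl (W ∖ y)` contains three basis points (`s ≤ 3`,
  i.e. the plane is a basis plane) settles the pair by itself (`9/2 ≥ 1`; `s = 3` gives `3/2`);
* **`basis_pair_fair_of_three_coloops`**: THREE coloop points whose planes each contain a basis point (`s ≤ 5`, terms `≥ 9/20`);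
* **`basis_pair_fair_of_four_coloops`**: FOUR coloop points (`s ≤ 6`, terms `≥ 3/10`) — the `N = 4` argument for any `N`.
Paper: proofs/NIGHT-2-g37.md §2.
-/

namespace PercRepro.Shadow

open PercRepro.ThmH PercRepro.PerFlat

variable {α : Type*} [DecidableEq α] {M : Matroid α} [M.Finite] {G : Finset α}

/-- The level-1 term of a coloop point with `s ≤ k` is at least `9 / (2 C(k, 2))`. -/
theorem level_one_term_ge_of_coloop_of_le (hG : G ∈ flatsQ M (5 + 1)) (hd : (gr M \ G).card = 2)
    (hk : kColoops M G = 1) (hs : ∀ e ∈ gr M, ∀ f ∈ gr M, e ≠ f → rkN M {e, f} = 2)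
    (hl : ∀ e ∈ gr M, M.Indep {e}) (hnf : fatClosures M 5 G 2 = ∅) {B : Finset α}
    (hB : B ∈ thinMembers M 5 G) (hnP : ¬ bigP M G B) {z : α} (hz : z ∈ G \ clF M B)
    (hl0 : loss M 5 G B z ≠ 0) {y : α} (hy : y ∈ G \ insert z B)
    (hr : rkN M ((G \ insert z B).erase y) ≤ 3) {k : ℕ}
    (hsk : ((insert y (insert z B) \ coloops M G) \ clF M ((G \ insert z B).erase y)).card ≤ k) :
    9 / (2 * ((k.choose 2 : ℕ) : ℚ)) ≤ vCap M G (insert y (insert z B)) / faceSum M G (insert y (insert z B)) := by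
  refine le_trans ?_ (level_one_term_ge_of_coloop hG hd hk hs hl hnf hB hnP hz hl0 hy hr)
  have hch : (((insert y (insert z B) \ coloops M G) \ clF M ((G \ insert z B).erase y)).card).choose 2 ≤ k.choose 2 :=
    Nat.choose_le_choose 2 hsk
  have hch' : ((((insert y (insert z B) \ coloops M G) \ clF M ((G \ insert z B).erase y)).card.choose 2 : ℕ) : ℚ)
      ≤ ((k.choose 2 : ℕ) : ℚ) := by exact_mod_cast hch
  have hpos := faceSum_pos_of_mem_tgtSets hG hd hk hB hnP hz hl0
    (level_one_targets_subset hG hB hz (Finset.mem_image.2 ⟨y, hy, rfl⟩))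
  have hle := faceSum_insert_le_choose hG hd hk hnf hB hnP hz hy hr
  have hcpos : (0 : ℚ) <
      ((((insert y (insert z B) \ coloops M G) \ clF M ((G \ insert z B).erase y)).card.choose 2 : ℕ) : ℚ) := by
    by_contra h
    rw [not_lt] at h
    linarith
  have hkpos : (0 : ℚ) < ((k.choose 2 : ℕ) : ℚ) := lt_of_lt_of_le hcpos hch'
  rw [div_le_div_iff₀ (by linarith) (by linarith)]
  nlinarith

/-- A coloop point's term is nonnegative, as is every level-1 term. -/
theorem level_one_term_nonneg (hG : G ∈ flatsQ M (5 + 1)) (hd : (gr M \ G).card = 2) (hk : kColoops M G = 1)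
    {B : Finset α} (hB : B ∈ thinMembers M 5 G) (hnP : ¬ bigP M G B) {z : α} (hz : z ∈ G \ clF M B)
    (hl0 : loss M 5 G B z ≠ 0) {y : α} (hy : y ∈ G \ insert z B) :
    0 ≤ vCap M G (insert y (insert z B)) / faceSum M G (insert y (insert z B)) :=
  div_nonneg (vCap_nonneg _) (faceSum_pos_of_mem_tgtSets hG hd hk hB hnP hz hl0
    (level_one_targets_subset hG hB hz (Finset.mem_image.2 ⟨y, hy, rfl⟩))).le

/-- **One coloop point whose plane contains three basis points settles the pair** (`s ≤ 3`, term `≥ 3/2`). -/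
theorem basis_pair_fair_of_coloop_s_le_three (hG : G ∈ flatsQ M (5 + 1)) (hd : (gr M \ G).card = 2)
    (hk : kColoops M G = 1) (hs : ∀ e ∈ gr M, ∀ f ∈ gr M, e ≠ f → rkN M {e, f} = 2)
    (hl : ∀ e ∈ gr M, M.Indep {e}) (hnf : fatClosures M 5 G 2 = ∅) {B : Finset α}
    (hB : B ∈ thinMembers M 5 G) (hnP : ¬ bigP M G B) {z : α} (hz : z ∈ G \ clF M B)
    (hl0 : loss M 5 G B z ≠ 0) {y : α} (hy : y ∈ G \ insert z B)
    (hr : rkN M ((G \ insert z B).erase y) ≤ 3)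
    (hs3 : ((insert y (insert z B) \ coloops M G) \ clF M ((G \ insert z B).erase y)).card ≤ 3) :
    loss M 5 G B z ≤ rhoL M 5 G B z * lossIncomeH M 5 G (bigP M G) (dshGT2 M 5 G) B z := by
  have hfat : (fatClosures M 5 G 2).card ≤ 1 := by
    rw [hnf, Finset.card_empty]
    exact zero_le_one
  apply basis_pair_fair_of_level_one_sum hG hd hk hs hl hfat hB hnP hz hl0
  have ht := level_one_term_ge_of_coloop_of_le hG hd hk hs hl hnf hB hnP hz hl0 hy hr hs3
  have h3 : (9 : ℚ) / (2 * ((Nat.choose 3 2 : ℕ) : ℚ)) = 3 / 2 := by norm_num [Nat.choose]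
  rw [h3] at ht
  calc (1 : ℚ) ≤ 3 / 2 := by norm_num
    _ ≤ vCap M G (insert y (insert z B)) / faceSum M G (insert y (insert z B)) := ht
    _ ≤ ∑ y' ∈ G \ insert z B, vCap M G (insert y' (insert z B)) / faceSum M G (insert y' (insert z B)) :=
        Finset.single_le_sum (fun y' hy' => level_one_term_nonneg hG hd hk hB hnP hz hl0 hy') hy

/-- **Three coloop points whose planes each contain a basis point settle the pair** (`s ≤ 5`, terms `≥ 9/20`). -/
theorem basis_pair_fair_of_three_coloops (hG : G ∈ flatsQ M (5 + 1)) (hd : (gr M \ G).card = 2)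
    (hk : kColoops M G = 1) (hs : ∀ e ∈ gr M, ∀ f ∈ gr M, e ≠ f → rkN M {e, f} = 2)
    (hl : ∀ e ∈ gr M, M.Indep {e}) (hnf : fatClosures M 5 G 2 = ∅) {B : Finset α}
    (hB : B ∈ thinMembers M 5 G) (hnP : ¬ bigP M G B) {z : α} (hz : z ∈ G \ clF M B)
    (hl0 : loss M 5 G B z ≠ 0) {Y : Finset α} (hY : Y ⊆ G \ insert z B) (hY3 : Y.card = 3)
    (hr : ∀ y ∈ Y, rkN M ((G \ insert z B).erase y) ≤ 3)
    (hs5 : ∀ y ∈ Y, ((insert y (insert z B) \ coloops M G) \ clF M ((G \ insert z B).erase y)).card ≤ 5) :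
    loss M 5 G B z ≤ rhoL M 5 G B z * lossIncomeH M 5 G (bigP M G) (dshGT2 M 5 G) B z := by
  have hfat : (fatClosures M 5 G 2).card ≤ 1 := by
    rw [hnf, Finset.card_empty]
    exact zero_le_one
  apply basis_pair_fair_of_level_one_sum hG hd hk hs hl hfat hB hnP hz hl0
  have hterm : ∀ y ∈ Y, (9 / 20 : ℚ) ≤ vCap M G (insert y (insert z B)) / faceSum M G (insert y (insert z B)) := by
    intro y hy
    have ht := level_one_term_ge_of_coloop_of_le hG hd hk hs hl hnf hB hnP hz hl0 (hY hy) (hr y hy) (hs5 y hy)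
    have h5 : (9 : ℚ) / (2 * ((Nat.choose 5 2 : ℕ) : ℚ)) = 9 / 20 := by norm_num [Nat.choose]
    rw [h5] at ht
    exact ht
  calc (1 : ℚ) ≤ (Y.card : ℚ) * (9 / 20) := by rw [hY3]; norm_num
    _ = ∑ _y ∈ Y, (9 / 20 : ℚ) := by rw [Finset.sum_const, nsmul_eq_mul]
    _ ≤ ∑ y ∈ Y, vCap M G (insert y (insert z B)) / faceSum M G (insert y (insert z B)) := Finset.sum_le_sum hterm
    _ ≤ ∑ y ∈ G \ insert z B, vCap M G (insert y (insert z B)) / faceSum M G (insert y (insert z B)) :=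
        Finset.sum_le_sum_of_subset_of_nonneg hY (fun y hy _ => level_one_term_nonneg hG hd hk hB hnP hz hl0 hy)

/-- **Four coloop points settle the pair** (`s ≤ 6`, terms `≥ 3/10`). -/
theorem basis_pair_fair_of_four_coloops (hG : G ∈ flatsQ M (5 + 1)) (hd : (gr M \ G).card = 2)
    (hk : kColoops M G = 1) (hs : ∀ e ∈ gr M, ∀ f ∈ gr M, e ≠ f → rkN M {e, f} = 2)
    (hl : ∀ e ∈ gr M, M.Indep {e}) (hnf : fatClosures M 5 G 2 = ∅) {B : Finset α}
    (hB : B ∈ thinMembers M 5 G) (hnP : ¬ bigP M G B) {z : α} (hz : z ∈ G \ clF M B)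
    (hl0 : loss M 5 G B z ≠ 0) {Y : Finset α} (hY : Y ⊆ G \ insert z B) (hY4 : Y.card = 4)
    (hr : ∀ y ∈ Y, rkN M ((G \ insert z B).erase y) ≤ 3) :
    loss M 5 G B z ≤ rhoL M 5 G B z * lossIncomeH M 5 G (bigP M G) (dshGT2 M 5 G) B z := by
  have hfat : (fatClosures M 5 G 2).card ≤ 1 := by
    rw [hnf, Finset.card_empty]
    exact zero_le_one
  apply basis_pair_fair_of_level_one_sum hG hd hk hs hl hfat hB hnP hz hl0
  have hterm : ∀ y ∈ Y, (3 / 10 : ℚ) ≤ vCap M G (insert y (insert z B)) / faceSum M G (insert y (insert z B)) := by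
    intro y hy
    have h6 := card_insert_sdiff_coloops_eq_six hG hd hk hB hnP hz (hY hy)
    have hs6 : ((insert y (insert z B) \ coloops M G) \ clF M ((G \ insert z B).erase y)).card ≤ 6 := by
      rw [← h6]
      exact Finset.card_le_card Finset.sdiff_subset
    have ht := level_one_term_ge_of_coloop_of_le hG hd hk hs hl hnf hB hnP hz hl0 (hY hy) (hr y hy) hs6
    have h6' : (9 : ℚ) / (2 * ((Nat.choose 6 2 : ℕ) : ℚ)) = 3 / 10 := by norm_num [Nat.choose]
    rw [h6'] at ht
    exact ht
  calc (1 : ℚ) ≤ (Y.card : ℚ) * (3 / 10) := by rw [hY4]; norm_num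
    _ = ∑ _y ∈ Y, (3 / 10 : ℚ) := by rw [Finset.sum_const, nsmul_eq_mul]
    _ ≤ ∑ y ∈ Y, vCap M G (insert y (insert z B)) / faceSum M G (insert y (insert z B)) := Finset.sum_le_sum hterm
    _ ≤ ∑ y ∈ G \ insert z B, vCap M G (insert y (insert z B)) / faceSum M G (insert y (insert z B)) :=
        Finset.sum_le_sum_of_subset_of_nonneg hY (fun y hy _ => level_one_term_nonneg hG hd hk hB hnP hz hl0 hy)

end PercRepro.Shadow
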